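import Summits.QuantumAdvantage.AdviceFreeQNC0.TwistBound
import Summits.QuantumAdvantage.AdviceFreeQNC0.WalkHardFJunta
import HarnessLib

/-!
# Regular linear-form strategies lose α's u-walk game (the analytic core of rung R11', every prime `p ≠ 3`)

Planner qa-qnc0-p2 g15, ROUND-15 (p2) §3.11, steps (2)–(4) of R11' `WalkHardFLinForms`: a strategy reading the input only
through the residue vector `V(u) ∈ (ℤ/p)^K` of `K` linear forms, `y_g(u) = tab g (V u)`, whose forms are `w`-REGULAR (every
non-trivial combination `β(γ) = Σ_j γ_j λ_j` has at least `w` non-zero coefficients) wins on at most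
`(θ₀ + 3√6·p^K·cos(π/(3p))^w)·2ⁿ` inputs, `θ₀ < 1` the constant-strategy bound (qn-prover g10's `walkHardFJunta` at `J = ∅`).
PROOF ("expand the cell, not the target"): `#win = Σ_v #{u : V u = v ∧ WIN_{Y_v}(u)}` with the CONSTANT strategies
`Y_v = {g : tab g v}`; qn-lit g18's `TwoModuli.sum_cell_eq_sum_twisted` expands the cell indicator over the `p^K` characters of
`(ℤ/p)^K`; the trivial character gives `p^{-K}·#WIN_{Y_v} ≤ p^{-K}θ₀2ⁿ`, every other one a twisted correlation bounded by
`TwistBound` (`twistBound`): `≤ 3√6·ρ^{#supp β(γ)}·2ⁿ ≤ 3√6·ρ^w·2ⁿ`.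
Main result: `LinForms.card_win_le_of_regular`.  R11' itself = this + the Chattopadhyay–Lovett regularisation (move the short
combinations into a junta; not here).
WHAT THIS IS NOT: no regularisation, so NOT `WalkHardFLinForms`; rung F-Q2-odd instrument; separation NOT moved.
-/

noncomputable section

namespace Summit.QuantumAdvantage.AdviceFreeQNC0

open Finset

namespace LinForms

variable {n K : ℕ} {p : ℕ} [Fact p.Prime]

/-- The residue vector of the `K` forms at `u`. -/
def resVec (lam : Fin K → Fin n → ZMod p) (u : Fin n → Bool) : Fin K → ZMod p :=
  fun j => ∑ i, if u i then lam j i else 0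

/-- The fired cuts of cell `v`. -/
def cellSet (tab : Fin (n + 1) → (Fin K → ZMod p) → Bool) (v : Fin K → ZMod p) : Finset (Fin (n + 1)) :=
  univ.filter fun g => tab g v = true

/-- The win indicator of the constant strategy of cell `v`, as a complex number. -/
def winC (c : ℕ) (tab : Fin (n + 1) → (Fin K → ZMod p) → Bool) (v : Fin K → ZMod p) (u : Fin n → Bool) : ℂ :=
  if ringWinU c (fun g _ => decide (g ∈ cellSet tab v)) u = true then 1 else 0

/-- `ringWinU` only reads the strategy at the input. -/
theorem ringWinU_congr (c : ℕ) {y y' : Fin (n + 1) → (Fin n → Bool) → Bool} {u : Fin n → Bool}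
    (h : ∀ g, y g u = y' g u) : ringWinU c y u = ringWinU c y' u := by
  unfold ringWinU
  simp only [h]

/-- At input `u` the linear-form strategy plays the constant strategy of its cell. -/
theorem win_linY_eq (c : ℕ) (lam : Fin K → Fin n → ZMod p) (tab : Fin (n + 1) → (Fin K → ZMod p) → Bool)
    (u : Fin n → Bool) :
    (if ringWinU c (fun g v => tab g (fun j => ∑ i, if v i then lam j i else 0)) u = true then (1 : ℂ) else 0) =
      winC c tab (resVec lam u) u := by
  unfold winC
  rw [ringWinU_congr c (y' := fun g _ => decide (g ∈ cellSet tab (resVec lam u))) (fun g => by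
    unfold cellSet resVec; simp)]

/-- **The win count split over the cells.** -/
theorem card_win_eq_sum_cells (c : ℕ) (lam : Fin K → Fin n → ZMod p) (tab : Fin (n + 1) → (Fin K → ZMod p) → Bool) :
    (((univ.filter fun u : Fin n → Bool =>
        ringWinU c (fun g v => tab g (fun j => ∑ i, if v i then lam j i else 0)) u = true).card : ℕ) : ℂ) =
      ∑ v : Fin K → ZMod p, ∑ u : Fin n → Bool,
        (if (fun j => ∑ i, if u i then lam j i else 0) = v then winC c tab v u else 0) := by
  classical
  rw [Finset.natCast_card_filter]
  rw [Finset.sum_comm]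
  refine Finset.sum_congr rfl fun u _ => ?_
  rw [win_linY_eq, Finset.sum_ite_eq, if_pos (Finset.mem_univ _)]
  rfl

/-- The trivial character's term is the plain win count of the cell's constant strategy. -/
theorem twisted_zero (c : ℕ) (tab : Fin (n + 1) → (Fin K → ZMod p) → Bool) (v : Fin K → ZMod p)
    (lam : Fin K → Fin n → ZMod p) :
    (∑ u : Fin n → Bool, (ZMod.stdAddChar (∑ i : Fin n, if u i then ∑ j, (0 : Fin K → ZMod p) j * lam j i else 0) : ℂ) *
        winC c tab v u) =
      ((univ.filter fun u : Fin n → Bool => ringWinU c (fun g _ => decide (g ∈ cellSet tab v)) u = true).card : ℂ) := by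
  rw [Finset.natCast_card_filter]
  refine Finset.sum_congr rfl fun u _ => ?_
  have h0 : (∑ i : Fin n, if u i then ∑ j, (0 : Fin K → ZMod p) j * lam j i else 0) = 0 :=
    Finset.sum_eq_zero fun i _ => by simp
  rw [h0, AddChar.map_zero_eq_one, one_mul]
  rfl

/-- A twisted term is bounded by `TwistBound`. -/
theorem norm_twisted_le (hp3 : p ≠ 3) (c : ℕ) (tab : Fin (n + 1) → (Fin K → ZMod p) → Bool) (v : Fin K → ZMod p)
    (β : Fin n → ZMod p) :
    ‖∑ u : Fin n → Bool, (ZMod.stdAddChar (∑ i : Fin n, if u i then β i else 0) : ℂ) * winC c tab v u‖ ≤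
      3 * Real.sqrt 6 * Real.cos (Real.pi / (3 * p)) ^ (univ.filter fun i => β i ≠ 0).card * (2 : ℝ) ^ n := by
  have h := twistBound p hp3 n c (cellSet tab v) β
  have heq : (∑ u : Fin n → Bool, (ZMod.stdAddChar (∑ i : Fin n, if u i then β i else 0) : ℂ) * winC c tab v u) =
      ∑ u : Fin n → Bool, (if ringWinU c (fun g _ => decide (g ∈ cellSet tab v)) u = true then (1 : ℂ) else 0) *
        Complex.exp (2 * Real.pi * Complex.I * (((∑ i, if u i then β i else 0).val : ℝ) : ℂ) / (p : ℂ)) := by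
    refine Finset.sum_congr rfl fun u _ => ?_
    rw [Literature.Computability.MetaComplexity.TwoModuli.exp_val_eq_stdAddChar]
    unfold winC
    ring
  rw [heq]
  exact h

end LinForms

open LinForms in
/-- **Regular linear-form strategies lose** (R11' without the regularisation step): for every prime `p ≠ 3` there are
`θ₀ < 1` and `n₀` such that for `n ≥ n₀`, every strategy `y_g(u) = tab g (Σ_{i : u_i} λ_{j,i})_j` whose forms are
`w`-regular wins α's u-walk game on at most `(θ₀ + 3√6·p^K·cos(π/(3p))^w)·2ⁿ` inputs. -/
theorem card_win_le_of_regular (p : ℕ) [Fact p.Prime] (hp3 : p ≠ 3) :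
    ∃ θ₀ : ℝ, θ₀ < 1 ∧ ∃ n₀ : ℕ, ∀ n ≥ n₀, ∀ (c K w : ℕ) (lam : Fin K → Fin n → ZMod p)
      (tab : Fin (n + 1) → (Fin K → ZMod p) → Bool),
      (∀ γ : Fin K → ZMod p, γ ≠ 0 → w ≤ (univ.filter fun i : Fin n => (∑ j, γ j * lam j i) ≠ 0).card) →
      ((univ.filter fun u : Fin n → Bool =>
          ringWinU c (fun g v => tab g (fun j => ∑ i, if v i then lam j i else 0)) u = true).card : ℝ) ≤
        (θ₀ + 3 * Real.sqrt 6 * (p : ℝ) ^ K * Real.cos (Real.pi / (3 * p)) ^ w) * (2 : ℝ) ^ n := by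
  classical
  obtain ⟨θ₀, hθ₀, H⟩ := walkHardFJunta p hp3
  obtain ⟨n₀, hn₀⟩ := H 0
  refine ⟨θ₀, hθ₀, n₀, fun n hn c K w lam tab hreg => ?_⟩
  set ρ : ℝ := Real.cos (Real.pi / (3 * p)) with hρ
  have hp2 : 2 ≤ p := (Fact.out : p.Prime).two_le
  have hρ0 : 0 ≤ ρ := by
    apply Real.cos_nonneg_of_neg_pi_div_two_le_of_le
    · have : 0 ≤ Real.pi / (3 * p) := by positivity
      linarith [Real.pi_pos]
    · rw [div_le_div_iff₀ (by positivity) (by norm_num)]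
      have : (2 : ℝ) ≤ p := by exact_mod_cast hp2
      nlinarith [Real.pi_pos]
  have hρ1 : ρ ≤ 1 := Real.cos_le_one _
  -- constant strategies
  have hconst : ∀ v : Fin K → ZMod p,
      ((univ.filter fun u : Fin n → Bool => ringWinU c (fun g _ => decide (g ∈ cellSet tab v)) u = true).card : ℝ) ≤
        θ₀ * (2 : ℝ) ^ n := by
    intro v
    exact hn₀ n hn c ∅ (by simp) _ (fun g u u' _ => rfl)
  -- the expansion
  set E : ℝ := 3 * Real.sqrt 6 * ρ ^ w * (2 : ℝ) ^ n with hE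
  have hE0 : 0 ≤ E := by positivity
  have hterm : ∀ (v γ : Fin K → ZMod p), ‖(ZMod.stdAddChar (-∑ j, γ j * v j) : ℂ) *
      ∑ u : Fin n → Bool, (ZMod.stdAddChar (∑ i : Fin n, if u i then ∑ j, γ j * lam j i else 0) : ℂ) * winC c tab v u‖ ≤
      (if γ = 0 then θ₀ * (2 : ℝ) ^ n else E) := by
    intro v γ
    rw [norm_mul, show ‖(ZMod.stdAddChar (-∑ j, γ j * v j) : ℂ)‖ = 1 from AddChar.norm_apply _ _, one_mul]
    by_cases hγ : γ = 0
    · rw [if_pos hγ, hγ, twisted_zero]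
      rw [Complex.norm_natCast]
      exact hconst v
    · rw [if_neg hγ]
      refine (norm_twisted_le hp3 c tab v _).trans ?_
      have hsupp := hreg γ hγ
      have : ρ ^ (univ.filter fun i : Fin n => (∑ j, γ j * lam j i) ≠ 0).card ≤ ρ ^ w :=
        pow_le_pow_of_le_one hρ0 hρ1 hsupp
      rw [hE]
      have h6 : 0 ≤ 3 * Real.sqrt 6 := by positivity
      have h2n : (0 : ℝ) ≤ (2 : ℝ) ^ n := by positivity
      nlinarith [mul_nonneg h6 h2n]
  have hcell : ∀ v : Fin K → ZMod p, ‖∑ u : Fin n → Bool,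
      (if (fun j => ∑ i, if u i then lam j i else 0) = v then winC c tab v u else 0)‖ ≤
      ((p : ℝ) ^ K)⁻¹ * (θ₀ * (2 : ℝ) ^ n + (p : ℝ) ^ K * E) := by
    intro v
    rw [Literature.Computability.MetaComplexity.TwoModuli.sum_cell_eq_sum_twisted lam v (winC c tab v), norm_mul,
      norm_inv, norm_pow, Complex.norm_natCast]
    refine mul_le_mul_of_nonneg_left ?_ (by positivity)
    refine (norm_sum_le _ _).trans ?_
    calc (∑ γ : Fin K → ZMod p, ‖(ZMod.stdAddChar (-∑ j, γ j * v j) : ℂ) *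
          ∑ u : Fin n → Bool, (ZMod.stdAddChar (∑ i : Fin n, if u i then ∑ j, γ j * lam j i else 0) : ℂ) *
            winC c tab v u‖)
        ≤ ∑ γ : Fin K → ZMod p, (if γ = 0 then θ₀ * (2 : ℝ) ^ n else E) := Finset.sum_le_sum fun γ _ => hterm v γ
      _ = θ₀ * (2 : ℝ) ^ n + ∑ γ ∈ (univ : Finset (Fin K → ZMod p)).erase 0, E := by
          rw [← Finset.add_sum_erase _ _ (mem_univ (0 : Fin K → ZMod p)), if_pos rfl]
          congr 1
          exact Finset.sum_congr rfl fun γ hγ => by rw [if_neg (Finset.ne_of_mem_erase hγ)]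
      _ ≤ θ₀ * (2 : ℝ) ^ n + (p : ℝ) ^ K * E := by
          rw [Finset.sum_const, nsmul_eq_mul]
          have hcard : (((univ : Finset (Fin K → ZMod p)).erase 0).card : ℝ) ≤ (p : ℝ) ^ K := by
            have h1 : ((univ : Finset (Fin K → ZMod p)).erase 0).card ≤ (univ : Finset (Fin K → ZMod p)).card :=
              Finset.card_erase_le
            rw [Finset.card_univ, Fintype.card_fun, ZMod.card, Fintype.card_fin] at h1
            exact_mod_cast h1
          nlinarith
  -- sum over the cells
  have hmain : ‖(((univ.filter fun u : Fin n → Bool =>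
      ringWinU c (fun g v => tab g (fun j => ∑ i, if v i then lam j i else 0)) u = true).card : ℕ) : ℂ)‖ ≤
      (p : ℝ) ^ K * (((p : ℝ) ^ K)⁻¹ * (θ₀ * (2 : ℝ) ^ n + (p : ℝ) ^ K * E)) := by
    rw [card_win_eq_sum_cells]
    refine (norm_sum_le _ _).trans ?_
    calc (∑ v : Fin K → ZMod p, ‖∑ u : Fin n → Bool,
          (if (fun j => ∑ i, if u i then lam j i else 0) = v then winC c tab v u else 0)‖)
        ≤ ∑ _v : Fin K → ZMod p, ((p : ℝ) ^ K)⁻¹ * (θ₀ * (2 : ℝ) ^ n + (p : ℝ) ^ K * E) :=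
          Finset.sum_le_sum fun v _ => hcell v
      _ = (p : ℝ) ^ K * (((p : ℝ) ^ K)⁻¹ * (θ₀ * (2 : ℝ) ^ n + (p : ℝ) ^ K * E)) := by
          rw [Finset.sum_const, nsmul_eq_mul, Finset.card_univ, Fintype.card_fun, ZMod.card, Fintype.card_fin]
          push_cast; ring
  rw [Complex.norm_natCast] at hmain
  have hpK : (p : ℝ) ^ K ≠ 0 := pow_ne_zero _ (by exact_mod_cast (Fact.out : p.Prime).ne_zero)
  rw [← mul_assoc, mul_inv_cancel₀ hpK, one_mul] at hmain
  rw [hE] at hmain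
  linarith

end Summit.QuantumAdvantage.AdviceFreeQNC0

end
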